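import Summits.QuantumFields.YangMills.Theorems.LangevinControlUVOSLegsFromFemtoAndGapDefs
import HarnessLib

/-!
# `FixedTorusFirst` — envelope and box-restriction lemmas for the functional strong-coupling rung

Route `route-QuantumFields-FixedTorusFirst` (sub-line under `BalabanLadder.NT`, rung R2a), crux
`Summit.QuantumFields.YangMills.Theses.FixedTorusFirst.FiniteSizeInsensitivity` (item
`stmt-QuantumFields-27355`).  Real-variable and combinatorial bookkeeping for
`FixedTorusFirstStrongCouplingFunctionalRung`:

* `pow_le_mul_exp` — `xⁿ ≤ (n/δ)ⁿ e^{δx}`;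
* `envelope_le` — the threshold `Λ₆(P, R, s₀, η, e)` beyond which
  `P (2⌊R/s⌋+3)^e 2^{−⌊(L−2−⌊R/s⌋)/3⌋} ≤ η` uniformly in the unit `0 < s ≤ s₀` (`s·L ≥ Λ₆`);
* `test_vanish` — a test function supported in the ball of radius `R` vanishes at the smearing
  points `s·x`, `x ∉ box ⌊R/s⌋`;
* `Q2_eq_sum_box`, `Q3_eq_sum_box` — restriction of NT's smearing sums `Q2`, `Q3` to that box;
* `exists_bound_and_radius` — sup bound and support radius of a compactly supported Schwartz
  function.

Pure bookkeeping: no statement about Wilson's measure is made here.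
-/

set_option autoImplicit false

noncomputable section

open scoped SchwartzMap
open Literature.Probability.LatticeModels
open Literature.MathematicalPhysics.QuantumLattice
open Literature.MathematicalPhysics.QuantumFieldTheory (LatticeRep)
open Summit.QuantumFields.YangMills.Cruxes.OSLegsFromFemtoAndGap.DlrCollarTransfer (dens torusE Q2
  Q3 torusK3)

namespace Summit.QuantumFields.YangMills.Cruxes.FiniteSizeInsensitivity.Rung


/-! ## Real-variable bookkeeping -/

/-- `xⁿ ≤ (n/δ)ⁿ e^{δx}` for `x ≥ 0`, `δ > 0`, `n ≥ 1`. -/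
theorem pow_le_mul_exp {n : ℕ} (hn : 0 < n) {δ : ℝ} (hδ : 0 < δ) {x : ℝ} (hx : 0 ≤ x) :
    x ^ n ≤ (n / δ) ^ n * Real.exp (δ * x) := by
  have hn' : (0 : ℝ) < n := by exact_mod_cast hn
  have h1 : δ * x / n ≤ Real.exp (δ * x / n) := by
    have := Real.add_one_le_exp (δ * x / n)
    linarith
  have h2 : x ≤ n / δ * Real.exp (δ * x / n) := by
    have h := mul_le_mul_of_nonneg_left h1 (by positivity : (0 : ℝ) ≤ n / δ)
    have e : n / δ * (δ * x / n) = x := by field_simp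
    linarith
  calc x ^ n ≤ (n / δ * Real.exp (δ * x / n)) ^ n := pow_le_pow_left₀ hx h2 n
    _ = (n / δ) ^ n * Real.exp (δ * x) := by
        rw [mul_pow, ← Real.exp_nat_mul]
        congr 2
        field_simp

/-- **The envelope.**  With `N = ⌊R/s⌋` and the threshold
`Λ₆ = max (2R + 8s₀ + 1) (P (2R+3s₀)^e (6e/log 2)^e / η + 1)`: whenever `0 < s ≤ s₀` and
`Λ₆ ≤ s·L`, one has `N + 4 ≤ L` and `P (2N+3)^e 2^{−⌊(L−2−N)/3⌋} ≤ η`. -/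
theorem envelope_le {P R s₀ η : ℝ} (hP : 0 ≤ P) (hR : 0 < R) (hs₀ : 0 < s₀) (hη : 0 < η) {e : ℕ}
    (he : 0 < e) {s : ℝ} (hs : 0 < s) (hss₀ : s ≤ s₀) {L : ℕ}
    (hL : max (2 * R + 8 * s₀ + 1)
      (P * (2 * R + 3 * s₀) ^ e * (6 * e / Real.log 2) ^ e / η + 1) ≤ s * L) :
    ⌊R / s⌋₊ + 4 ≤ L ∧
      P * (2 * (⌊R / s⌋₊ : ℝ) + 3) ^ e * (1 / 2 : ℝ) ^ ((L - 1 - (⌊R / s⌋₊ + 1)) / 3) ≤ η := by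
  set N : ℕ := ⌊R / s⌋₊ with hN
  set Λ₆ : ℝ := max (2 * R + 8 * s₀ + 1)
    (P * (2 * R + 3 * s₀) ^ e * (6 * e / Real.log 2) ^ e / η + 1) with hΛ₆
  have hlog2 : 0 < Real.log 2 := Real.log_pos (by norm_num)
  have hΛ1 : 2 * R + 8 * s₀ + 1 ≤ Λ₆ := le_max_left _ _
  have hΛ2 : P * (2 * R + 3 * s₀) ^ e * (6 * e / Real.log 2) ^ e / η + 1 ≤ Λ₆ := le_max_right _ _
  have hΛpos : 0 < Λ₆ := by linarith
  have hΛone : 1 ≤ Λ₆ := by nlinarith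
  -- `u = 1/s ≥ 1/s₀`
  obtain ⟨u, hu⟩ : ∃ u : ℝ, u = s⁻¹ := ⟨_, rfl⟩
  have hu0 : 0 < u := by rw [hu]; positivity
  have hsu : s * u = 1 := by rw [hu]; field_simp
  have hs₀u : 1 ≤ s₀ * u := by
    rw [hu]; rw [le_mul_inv_iff₀ hs]; linarith
  have hLu : Λ₆ * u ≤ L := by
    have h := mul_le_mul_of_nonneg_right hL hu0.le
    have e1 : s * (L : ℝ) * u = L := by rw [mul_right_comm, hsu, one_mul]
    rwa [e1] at h
  have hNu : (N : ℝ) ≤ R * u := by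
    have h := Nat.floor_le (by positivity : 0 ≤ R / s)
    rw [hN, hu, ← div_eq_mul_inv]; exact h
  have hNu' : R * u < N + 1 := by
    have h := Nat.lt_floor_add_one (R / s)
    rw [hN, hu, ← div_eq_mul_inv]; exact h
  -- `N + 4 ≤ L`
  have hN4 : (N : ℝ) + 4 ≤ L := by
    have h1 : (N : ℝ) + 4 ≤ R * u + 4 * (s₀ * u) := by linarith
    have h2 : R * u + 4 * (s₀ * u) = (R + 4 * s₀) * u := by ring
    have h3 : (R + 4 * s₀) * u ≤ Λ₆ * u := mul_le_mul_of_nonneg_right (by linarith) hu0.le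
    linarith
  have hN4' : N + 4 ≤ L := by exact_mod_cast hN4
  refine ⟨hN4', ?_⟩
  -- the exponent: `3k ≥ L − N − 4 ≥ Λ₆ u / 2`
  obtain ⟨k, hk⟩ : ∃ k : ℕ, k = (L - 1 - (N + 1)) / 3 := ⟨_, rfl⟩
  rw [← hk]
  have hk3 : L - N - 4 ≤ 3 * k := by omega
  have hkr : ((L : ℝ) - N - 4) ≤ 3 * k := by
    have h : ((L - N - 4 : ℕ) : ℝ) ≤ 3 * k := by exact_mod_cast hk3
    have h' : ((L - N - 4 : ℕ) : ℝ) = (L : ℝ) - N - 4 := by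
      rw [Nat.cast_sub (by omega), Nat.cast_sub (by omega)]
      push_cast; ring
    linarith
  have hku : Λ₆ * u / 6 ≤ k := by
    have h1 : (L : ℝ) - N - 4 ≥ Λ₆ * u - R * u - 4 * (s₀ * u) := by linarith
    have h2 : Λ₆ * u - R * u - 4 * (s₀ * u) = (Λ₆ - R - 4 * s₀) * u := by ring
    have h3 : Λ₆ / 2 * u ≤ (Λ₆ - R - 4 * s₀) * u :=
      mul_le_mul_of_nonneg_right (by linarith) hu0.le
    linarith
  have hhalf : (1 / 2 : ℝ) ^ k ≤ Real.exp (-(Real.log 2 / 6 * Λ₆ * u)) := by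
    have e1 : (1 / 2 : ℝ) ^ k = Real.exp (-(Real.log 2 * k)) := by
      rw [← Real.exp_log (by norm_num : (0 : ℝ) < 1 / 2), ← Real.exp_nat_mul, one_div,
        Real.log_inv]
      congr 1
      ring
    rw [e1, Real.exp_le_exp]
    have h := mul_le_mul_of_nonneg_left hku hlog2.le
    linarith
  -- the polynomial: `2N + 3 ≤ (2R + 3s₀) u`
  have hpoly : 2 * (N : ℝ) + 3 ≤ (2 * R + 3 * s₀) * u := by nlinarith
  have hpoly0 : 0 ≤ 2 * (N : ℝ) + 3 := by positivity
  have hpow : (2 * (N : ℝ) + 3) ^ e ≤ (2 * R + 3 * s₀) ^ e * u ^ e := by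
    rw [← mul_pow]; exact pow_le_pow_left₀ hpoly0 hpoly e
  -- `u^e e^{-δu} ≤ (e/δ)^e`, `δ = (log 2 / 6) Λ₆`
  have hδ : 0 < Real.log 2 / 6 * Λ₆ := by positivity
  have hue := pow_le_mul_exp he hδ hu0.le
  have hratio : (e : ℝ) / (Real.log 2 / 6 * Λ₆) = 6 * e / Real.log 2 / Λ₆ := by
    field_simp
  rw [hratio] at hue
  have hexp0 : 0 < Real.exp (-(Real.log 2 / 6 * Λ₆ * u)) := Real.exp_pos _
  have hmain : u ^ e * Real.exp (-(Real.log 2 / 6 * Λ₆ * u)) ≤ (6 * e / Real.log 2 / Λ₆) ^ e := by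
    have h := mul_le_mul_of_nonneg_right hue hexp0.le
    have e0 : (6 * e / Real.log 2 / Λ₆) ^ e * Real.exp (Real.log 2 / 6 * Λ₆ * u) *
        Real.exp (-(Real.log 2 / 6 * Λ₆ * u)) = (6 * e / Real.log 2 / Λ₆) ^ e := by
      rw [mul_assoc, ← Real.exp_add, add_neg_cancel, Real.exp_zero, mul_one]
    rwa [e0] at h
  -- `(c/Λ₆)^e ≤ c^e/Λ₆`
  have hce : (6 * e / Real.log 2 / Λ₆) ^ e ≤ (6 * e / Real.log 2) ^ e / Λ₆ := by
    rw [div_pow]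
    refine div_le_div_of_nonneg_left (by positivity) hΛpos ?_
    exact le_self_pow₀ hΛone he.ne'
  -- assemble
  have hQ : P * (2 * R + 3 * s₀) ^ e * (6 * e / Real.log 2) ^ e / Λ₆ ≤ η := by
    have h1 : P * (2 * R + 3 * s₀) ^ e * (6 * e / Real.log 2) ^ e / η ≤ Λ₆ := by linarith
    rw [div_le_iff₀ hΛpos]
    have h2 := (div_le_iff₀ hη).1 h1
    nlinarith
  calc P * (2 * (N : ℝ) + 3) ^ e * (1 / 2 : ℝ) ^ k
      ≤ P * ((2 * R + 3 * s₀) ^ e * u ^ e) * Real.exp (-(Real.log 2 / 6 * Λ₆ * u)) :=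
        mul_le_mul (mul_le_mul_of_nonneg_left hpow hP) hhalf (by positivity) (by positivity)
    _ = P * (2 * R + 3 * s₀) ^ e * (u ^ e * Real.exp (-(Real.log 2 / 6 * Λ₆ * u))) := by ring
    _ ≤ P * (2 * R + 3 * s₀) ^ e * (6 * e / Real.log 2 / Λ₆) ^ e :=
        mul_le_mul_of_nonneg_left hmain (by positivity)
    _ ≤ P * (2 * R + 3 * s₀) ^ e * ((6 * e / Real.log 2) ^ e / Λ₆) :=
        mul_le_mul_of_nonneg_left hce (by positivity)
    _ = P * (2 * R + 3 * s₀) ^ e * (6 * e / Real.log 2) ^ e / Λ₆ := by ring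
    _ ≤ η := hQ

/-! ## Compactly supported test functions see only a fixed box of sites -/

/-- A test function vanishing outside the ball of radius `Rf ≤ R` vanishes at every smearing point
`s·x` with `x` outside the box of radius `N`, as soon as `R/s < N + 1`. -/
theorem test_vanish {f : EuclideanSpace ℝ (Fin 4) → ℝ} {Rf R s : ℝ}
    (hRf : ∀ p, Rf ≤ ‖p‖ → f p = 0) (hRfR : Rf ≤ R) (hs : 0 < s) {N : ℕ}
    (hN : R / s < N + 1) {x : Site 4} (hx : x ∉ box 4 N) : f (s • siteToE x) = 0 := by
  apply hRf
  simp only [mem_box, not_forall, not_and, not_le] at hx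
  obtain ⟨i, hi⟩ := hx
  have hxi : (N : ℝ) + 1 ≤ |(x i : ℝ)| := by
    have h : (N : ℤ) + 1 ≤ |x i| := by
      rcases le_or_gt (-(N : ℤ)) (x i) with h1 | h1
      · have := hi h1; rw [abs_of_nonneg (by omega)]; omega
      · rw [abs_of_neg (by omega)]; omega
    exact_mod_cast h
  have hcoord : |(x i : ℝ)| ≤ ‖siteToE x‖ := by
    have h := PiLp.norm_apply_le (siteToE x) i
    rwa [siteToE_apply, Real.norm_eq_abs] at h
  rw [norm_smul, Real.norm_eq_abs, abs_of_pos hs]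
  have h1 : R < s * (N + 1) := by
    rw [div_lt_iff₀ hs] at hN
    linarith
  nlinarith [hcoord, hxi, hs]

/-! ## The functional strong-coupling rung -/

section Functional

variable {G : Type} [Group G] [TopologicalSpace G] [IsTopologicalGroup G] [CompactSpace G]
  [MeasurableSpace G] [BorelSpace G] (r : LatticeRep G)

/-- Restriction of the double smearing sum of `Q2` to the box carrying the test functions. -/
theorem Q2_eq_sum_box {N L : ℕ} (hNL : N ≤ L) (β s : ℝ) (f g : 𝓢(EuclideanSpace ℝ (Fin 4), ℝ))
    (hvf : ∀ x : Site 4, x ∉ box 4 N → f (s • siteToE x) = 0)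
    (hvg : ∀ y : Site 4, y ∉ box 4 N → g (s • siteToE y) = 0) :
    Q2 G r β L s f g = ∑ x ∈ box 4 N, ∑ y ∈ box 4 N, f (s • siteToE x) * g (s • siteToE y) *
      (torusE G r β L (fun U => dens G r x U * dens G r y U) -
        torusE G r β L (dens G r x) * torusE G r β L (dens G r y)) := by
  have hsub : box 4 N ⊆ box 4 L := box_mono 4 hNL
  rw [Q2, ← Finset.sum_subset hsub]
  · refine Finset.sum_congr rfl fun x _ => ?_
    rw [← Finset.sum_subset hsub]
    intro y _ hy
    rw [hvg y hy, mul_zero, zero_mul]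
  · intro x _ hx
    refine Finset.sum_eq_zero fun y _ => ?_
    rw [hvf x hx, zero_mul, zero_mul]

/-- Restriction of the triple smearing sum of `Q3` to the box carrying the test functions. -/
theorem Q3_eq_sum_box {N L : ℕ} (hNL : N ≤ L) (β s : ℝ)
    (f g h : 𝓢(EuclideanSpace ℝ (Fin 4), ℝ))
    (hvf : ∀ x : Site 4, x ∉ box 4 N → f (s • siteToE x) = 0)
    (hvg : ∀ y : Site 4, y ∉ box 4 N → g (s • siteToE y) = 0)
    (hvh : ∀ z : Site 4, z ∉ box 4 N → h (s • siteToE z) = 0) :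
    Q3 G r β L s f g h = ∑ x ∈ box 4 N, ∑ y ∈ box 4 N, ∑ z ∈ box 4 N,
      f (s • siteToE x) * g (s • siteToE y) * h (s • siteToE z) * torusK3 G r β L x y z := by
  have hsub : box 4 N ⊆ box 4 L := box_mono 4 hNL
  rw [Q3, ← Finset.sum_subset hsub]
  · refine Finset.sum_congr rfl fun x _ => ?_
    rw [← Finset.sum_subset hsub]
    · refine Finset.sum_congr rfl fun y _ => ?_
      rw [← Finset.sum_subset hsub]
      intro z _ hz
      rw [hvh z hz, mul_zero, zero_mul]
    · intro y _ hy
      refine Finset.sum_eq_zero fun z _ => ?_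
      rw [hvg y hy, mul_zero, zero_mul, zero_mul]
  · intro x _ hx
    refine Finset.sum_eq_zero fun y _ => Finset.sum_eq_zero fun z _ => ?_
    rw [hvf x hx, zero_mul, zero_mul, zero_mul]

/-- A compactly supported Schwartz function is bounded by a nonnegative constant and vanishes
outside a ball. -/
theorem exists_bound_and_radius (f : 𝓢(EuclideanSpace ℝ (Fin 4), ℝ))
    (hf : HasCompactSupport (f : EuclideanSpace ℝ (Fin 4) → ℝ)) :
    ∃ M R : ℝ, 0 ≤ M ∧ 0 < R ∧ (∀ p, |f p| ≤ M) ∧ ∀ p, R ≤ ‖p‖ → f p = 0 := by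
  obtain ⟨M, hM⟩ := f.continuous.bounded_above_of_compact_support hf
  obtain ⟨R, hR0, hR⟩ := hf.exists_pos_le_norm
  refine ⟨max M 0, R, le_max_right _ _, hR0, fun p => ?_, hR⟩
  have h := hM p
  rw [Real.norm_eq_abs] at h
  exact h.trans (le_max_left _ _)

end Functional

end Summit.QuantumFields.YangMills.Cruxes.FiniteSizeInsensitivity.Rung

end
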